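import Summits.CriticalPhenomena.Ising3DConformalLimit.Theses.InverseSquareTelemetry
import Summits.CriticalPhenomena.Ising3DConformalLimit.Theorems.InverseSquareTelemetryPowerLawFromTelemetry
import Summits.CriticalPhenomena.Ising3DConformalLimit.Theorems.InverseSquareTelemetryPositiveSolutionAsymptoticsFinal
import HarnessLib

/-!
# Crux `InverseSquareLaw` (stmt-CriticalPhenomena-4495) is at least the milestone 0634

Route `InverseSquareTelemetry`, sub-problem `Ising3DConformalLimit`; THEOREM-ONLY helper file
(`--supports stmt-CriticalPhenomena-4495`, strategist r1, STRATEGY-CENSUS r1 §5).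

The inverse-square telemetry law (crux, item 4495) implies the rotation-invariant pure power law
`IsingEuclidUpgradeR2RotInvPowerLaw` (item stmt-CriticalPhenomena-0634: `G(x)·|x|₂^{2Δ} → c > 0`
cofinitely on `ℤ³`, `G = criticalTwoPoint 3`) — by composing two LANDED route theorems: the glue
`powerLawFromTelemetry_proof` (item 4498: telemetry + positive-solution asymptotics ⟹ power law) and
`positiveSolutionAsymptotics_proof` (item 4496, the discrete potential theory of `Δ + V` with an
inverse-square `V`).  So every proof of the crux proves in particular existence of `η` and full
rotational symmetry of the critical two-point function of the nearest-neighbour Ising model on `ℤ³`.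
The converse is not expected as an implication of statements: from 0634 one extracts only the AXIAL
half of the rate-free telemetric limit (`AxialTelemetry.axialTelemetry_of_rotInvPowerLaw`), not the
transverse second-order content nor the rate.
-/

namespace Summit.CriticalPhenomena.Ising3DConformalLimit.Theorems

open Summit.CriticalPhenomena.Ising3DConformalLimit.Theses.InverseSquareTelemetry

/-- **Crux ⟹ milestone.** `InverseSquareLaw → IsingEuclidUpgradeR2RotInvPowerLaw` (item 4495 ⟹ item
0634), the composition of the landed items 4498 and 4496. [this work] -/
theorem rotInvPowerLaw_of_inverseSquareLaw (h : InverseSquareLaw) :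
    IsingEuclidUpgradeR2RotInvPowerLaw :=
  powerLawFromTelemetry_proof h positiveSolutionAsymptotics_proof

end Summit.CriticalPhenomena.Ising3DConformalLimit.Theorems
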